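import Literature.Probability.Percolation.ComplementPatternCounts
import HarnessLib

/-!
# The colour-swap identity for complementary-pair counts (3-point CPI bookkeeping)

Crux `stmt-CriticalPhenomena-4575`, route `PercNearOneGluingNoHeavy`, fibre line (lead memo g135 §7e,
facecert memo gen 24 §1).  For a finite multigraph `(V, α, ends)` and points `s, b, c` the 3-point
complementary-pair inequality CPI₂ reads `B₃ ≤ 2 A₃` with
`A₃ = #{z : s ↮ b in z, c ↔ {s,b} in z}` and `B₃ = #{z : s ↮ b in z, c ↔ {s,b} in z̄}` (`z̄` the
coordinatewise complement).  Writing `F z := s ↮ b in z`, `X z := c ↔ {s,b} in z` and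
`T(f_R x_R f_B x_B)` for the joint counts of `(F z, X z, F z̄, X z̄)`, the complement map is a
bijection of the cube exchanging the cells `T(1011)` and `T(1110)`, which gives the exact identity
`B₃ + T(1100) = A₃ + T(1001)` and hence `CPI₂ ⟺ T(1001) ≤ A₃ + T(1100)`: only the configurations
with `s ↔ b` in the complement need an argument; those with `s ↮ b` in both colours are matched
one-to-one by the swap.  The identity is purely formal (any involution, any two predicates), so it is
proved abstractly first (`card_swap_identity`) and then specialised; the abstract form applies
verbatim to the 4-point counts (`F = {s ↔ a, s ↮ b}`).

No definitions; statements are spelled out with `Finset.filter` in the vocabulary of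
`Literature/Probability/Percolation/ComplementPatternCounts.lean` (`labelledOpen`, `openGraph`).
-/

namespace Summit.CriticalPhenomena.PercolationContinuityZ3.Theorems.ThreePointCPISigma

open Finset Literature.Probability.Percolation

section Abstract

variable {Ω : Type*} [Fintype Ω]

/-- **Swap bijection of two cells.** For an involution `σ` of a finite type and predicates `F, X`,
the cell `{F z, ¬X z, F (σ z), X (σ z)}` is carried by `σ` onto the cell
`{F z, X z, F (σ z), ¬X (σ z)}`, so the two cells have the same size. [folklore] -/
theorem card_cell_swap (σ : Ω → Ω) (hσ : Function.Involutive σ) (F X : Ω → Prop)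
    [DecidablePred F] [DecidablePred X] :
    (univ.filter fun z => F z ∧ ¬ X z ∧ F (σ z) ∧ X (σ z)).card =
      (univ.filter fun z => F z ∧ X z ∧ F (σ z) ∧ ¬ X (σ z)).card := by
  classical
  have h : (univ.filter fun z => F z ∧ X z ∧ F (σ z) ∧ ¬ X (σ z)) =
      (univ.filter fun z => F z ∧ ¬ X z ∧ F (σ z) ∧ X (σ z)).image σ := by
    ext z
    simp only [mem_filter, mem_univ, true_and, mem_image]
    constructor
    · rintro ⟨h1, h2, h3, h4⟩
      exact ⟨σ z, ⟨h3, h4, by rw [hσ z]; exact h1, by rw [hσ z]; exact h2⟩, hσ z⟩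
    · rintro ⟨w, ⟨h1, h2, h3, h4⟩, rfl⟩
      exact ⟨h3, h4, by rw [hσ w]; exact h1, by rw [hσ w]; exact h2⟩
  rw [h, card_image_of_injective _ hσ.injective]

/-- **The swap identity.** For an involution `σ` of a finite type and predicates `F, X`:
`#{F z ∧ X (σ z)} + #{F z ∧ X z ∧ ¬F (σ z) ∧ ¬X (σ z)} = #{F z ∧ X z} + #{F z ∧ ¬X z ∧ ¬F (σ z) ∧ X (σ z)}`
(`L + T(1100) = M + T(1001)`): split `L` by `X z` and then by `F (σ z)`, split `M` by `X (σ z)`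
and then by `F (σ z)`, and use `card_cell_swap` for the two odd cells. [folklore] -/
theorem card_swap_identity (σ : Ω → Ω) (hσ : Function.Involutive σ) (F X : Ω → Prop)
    [DecidablePred F] [DecidablePred X] :
    (univ.filter fun z => F z ∧ X (σ z)).card +
        (univ.filter fun z => F z ∧ X z ∧ ¬ F (σ z) ∧ ¬ X (σ z)).card =
      (univ.filter fun z => F z ∧ X z).card +
        (univ.filter fun z => F z ∧ ¬ X z ∧ ¬ F (σ z) ∧ X (σ z)).card := by
  classical
  -- split L = {F z ∧ X (σ z)} along X z
  have hL := card_filter_add_card_filter_not (s := univ.filter fun z => F z ∧ X (σ z))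
    (fun z => X z)
  rw [filter_filter, filter_filter] at hL
  -- split the part {F z ∧ X (σ z) ∧ ¬ X z} along F (σ z)
  have hL2 := card_filter_add_card_filter_not
    (s := univ.filter fun z => (F z ∧ X (σ z)) ∧ ¬ X z) (fun z => F (σ z))
  rw [filter_filter, filter_filter] at hL2
  -- split M = {F z ∧ X z} along X (σ z)
  have hM := card_filter_add_card_filter_not (s := univ.filter fun z => F z ∧ X z)
    (fun z => X (σ z))
  rw [filter_filter, filter_filter] at hM
  -- split the part {F z ∧ X z ∧ ¬ X (σ z)} along F (σ z)
  have hM2 := card_filter_add_card_filter_not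
    (s := univ.filter fun z => (F z ∧ X z) ∧ ¬ X (σ z)) (fun z => F (σ z))
  rw [filter_filter, filter_filter] at hM2
  -- identify the common cell {F z ∧ X z ∧ X (σ z)} on both sides
  have hC : (univ.filter fun z => (F z ∧ X (σ z)) ∧ X z).card =
      (univ.filter fun z => (F z ∧ X z) ∧ X (σ z)).card := by
    congr 1; ext z; simp only [mem_filter, mem_univ, true_and]; tauto
  -- the two odd cells are exchanged by σ
  have hS := card_cell_swap σ hσ F X
  have hS1 : (univ.filter fun z => ((F z ∧ X (σ z)) ∧ ¬ X z) ∧ F (σ z)).card =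
      (univ.filter fun z => F z ∧ ¬ X z ∧ F (σ z) ∧ X (σ z)).card := by
    congr 1; ext z; simp only [mem_filter, mem_univ, true_and]; tauto
  have hS2 : (univ.filter fun z => ((F z ∧ X z) ∧ ¬ X (σ z)) ∧ F (σ z)).card =
      (univ.filter fun z => F z ∧ X z ∧ F (σ z) ∧ ¬ X (σ z)).card := by
    congr 1; ext z; simp only [mem_filter, mem_univ, true_and]; tauto
  -- the two cells kept on each side
  have hT1001 : (univ.filter fun z => ((F z ∧ X (σ z)) ∧ ¬ X z) ∧ ¬ F (σ z)).card =
      (univ.filter fun z => F z ∧ ¬ X z ∧ ¬ F (σ z) ∧ X (σ z)).card := by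
    congr 1; ext z; simp only [mem_filter, mem_univ, true_and]; tauto
  have hT1100 : (univ.filter fun z => ((F z ∧ X z) ∧ ¬ X (σ z)) ∧ ¬ F (σ z)).card =
      (univ.filter fun z => F z ∧ X z ∧ ¬ F (σ z) ∧ ¬ X (σ z)).card := by
    congr 1; ext z; simp only [mem_filter, mem_univ, true_and]; tauto
  omega

/-- **CPI₂ in swap form.** For an involution `σ` and predicates `F, X`:
`#{F z ∧ X (σ z)} ≤ 2 · #{F z ∧ X z}` iff `#{F z ∧ ¬X z ∧ ¬F (σ z) ∧ X (σ z)} ≤ #{F z ∧ X z} + #{F z ∧ X z ∧ ¬F (σ z) ∧ ¬X (σ z)}`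
(`L ≤ 2M ⟺ T(1001) ≤ M + T(1100)`). [folklore] -/
theorem two_mul_le_iff_swap (σ : Ω → Ω) (hσ : Function.Involutive σ) (F X : Ω → Prop)
    [DecidablePred F] [DecidablePred X] :
    (univ.filter fun z => F z ∧ X (σ z)).card ≤ 2 * (univ.filter fun z => F z ∧ X z).card ↔
      (univ.filter fun z => F z ∧ ¬ X z ∧ ¬ F (σ z) ∧ X (σ z)).card ≤
        (univ.filter fun z => F z ∧ X z).card +
          (univ.filter fun z => F z ∧ X z ∧ ¬ F (σ z) ∧ ¬ X (σ z)).card := by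
  have h := card_swap_identity σ hσ F X
  omega

end Abstract

/-! ### Specialisation to the 3-point complementary-pair counts of a multigraph -/

variable {V α : Type*} [Fintype α] [DecidableEq α]

omit [Fintype α] [DecidableEq α] in
/-- The coordinatewise complement `z ↦ z̄` of labelled configurations is an involution. [folklore] -/
theorem flip_involutive : Function.Involutive (fun z : α → Bool => fun a => !z a) := by
  intro z; funext a; simp

open Classical in
/-- **The σ-identity for the 3-point counts** (facecert gen 24, memo §1): with
`F z = s ↮ b` and `X z = c ↔ s ∨ c ↔ b` in the open graph of `z`, and `z̄ = fun a => !z a`,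
`B₃ + T(1100) = A₃ + T(1001)`, i.e.
`#{s↮b in z, c↔T in z̄} + #{s↮b, c↔T in z, s↔b in z̄, c↮T in z̄} = #{s↮b, c↔T in z} + #{s↮b, c↮T in z, s↔b in z̄, c↔T in z̄}`.
[folklore] -/
theorem threePoint_sigma_identity (ends : α → Sym2 V) (s b c : V) :
    (univ.filter fun z : α → Bool =>
        ¬ (openGraph (labelledOpen ends z)).Reachable s b ∧
        ((openGraph (labelledOpen ends fun a => !z a)).Reachable c s ∨
          (openGraph (labelledOpen ends fun a => !z a)).Reachable c b)).card +
      (univ.filter fun z : α → Bool =>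
        ¬ (openGraph (labelledOpen ends z)).Reachable s b ∧
        ((openGraph (labelledOpen ends z)).Reachable c s ∨
          (openGraph (labelledOpen ends z)).Reachable c b) ∧
        (openGraph (labelledOpen ends fun a => !z a)).Reachable s b ∧
        ¬ ((openGraph (labelledOpen ends fun a => !z a)).Reachable c s ∨
          (openGraph (labelledOpen ends fun a => !z a)).Reachable c b)).card =
    (univ.filter fun z : α → Bool =>
        ¬ (openGraph (labelledOpen ends z)).Reachable s b ∧
        ((openGraph (labelledOpen ends z)).Reachable c s ∨
          (openGraph (labelledOpen ends z)).Reachable c b)).card +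
      (univ.filter fun z : α → Bool =>
        ¬ (openGraph (labelledOpen ends z)).Reachable s b ∧
        ¬ ((openGraph (labelledOpen ends z)).Reachable c s ∨
          (openGraph (labelledOpen ends z)).Reachable c b) ∧
        (openGraph (labelledOpen ends fun a => !z a)).Reachable s b ∧
        ((openGraph (labelledOpen ends fun a => !z a)).Reachable c s ∨
          (openGraph (labelledOpen ends fun a => !z a)).Reachable c b)).card := by
  have h := card_swap_identity (fun z : α → Bool => fun a => !z a) flip_involutive
    (fun z => ¬ (openGraph (labelledOpen ends z)).Reachable s b)
    (fun z => (openGraph (labelledOpen ends z)).Reachable c s ∨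
      (openGraph (labelledOpen ends z)).Reachable c b)
  simpa only [not_not] using h

open Classical in
/-- **3-point CPI₂ ⟺ its swap form** (facecert gen 24, memo §1):
`B₃ ≤ 2 A₃ ⟺ #{s↮b, c↮T in z; s↔b, c↔T in z̄} ≤ A₃ + #{s↮b, c↔T in z; s↔b, c↮T in z̄}` — the
configurations with `s ↮ b` in both `z` and `z̄` cancel (they are exchanged by the complement map),
so only those with `s ↔ b` in the complement have to be placed. [folklore] -/
theorem threePoint_cpi_two_iff_swap (ends : α → Sym2 V) (s b c : V) :
    (univ.filter fun z : α → Bool =>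
        ¬ (openGraph (labelledOpen ends z)).Reachable s b ∧
        ((openGraph (labelledOpen ends fun a => !z a)).Reachable c s ∨
          (openGraph (labelledOpen ends fun a => !z a)).Reachable c b)).card ≤
      2 * (univ.filter fun z : α → Bool =>
        ¬ (openGraph (labelledOpen ends z)).Reachable s b ∧
        ((openGraph (labelledOpen ends z)).Reachable c s ∨
          (openGraph (labelledOpen ends z)).Reachable c b)).card ↔
    (univ.filter fun z : α → Bool =>
        ¬ (openGraph (labelledOpen ends z)).Reachable s b ∧
        ¬ ((openGraph (labelledOpen ends z)).Reachable c s ∨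
          (openGraph (labelledOpen ends z)).Reachable c b) ∧
        (openGraph (labelledOpen ends fun a => !z a)).Reachable s b ∧
        ((openGraph (labelledOpen ends fun a => !z a)).Reachable c s ∨
          (openGraph (labelledOpen ends fun a => !z a)).Reachable c b)).card ≤
      (univ.filter fun z : α → Bool =>
        ¬ (openGraph (labelledOpen ends z)).Reachable s b ∧
        ((openGraph (labelledOpen ends z)).Reachable c s ∨
          (openGraph (labelledOpen ends z)).Reachable c b)).card +
      (univ.filter fun z : α → Bool =>
        ¬ (openGraph (labelledOpen ends z)).Reachable s b ∧
        ((openGraph (labelledOpen ends z)).Reachable c s ∨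
          (openGraph (labelledOpen ends z)).Reachable c b) ∧
        (openGraph (labelledOpen ends fun a => !z a)).Reachable s b ∧
        ¬ ((openGraph (labelledOpen ends fun a => !z a)).Reachable c s ∨
          (openGraph (labelledOpen ends fun a => !z a)).Reachable c b)).card := by
  have h := two_mul_le_iff_swap (fun z : α → Bool => fun a => !z a) flip_involutive
    (fun z => ¬ (openGraph (labelledOpen ends z)).Reachable s b)
    (fun z => (openGraph (labelledOpen ends z)).Reachable c s ∨
      (openGraph (labelledOpen ends z)).Reachable c b)
  simpa only [not_not] using h

end Summit.CriticalPhenomena.PercolationContinuityZ3.Theorems.ThreePointCPISigma
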